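import Summits.AtomisticToContinuum.Crystallization.Theorems.FrustratedLawDichotomyStrainedPatchHomTermPointBounds
import Literature.Analysis.ValidatedNumerics.FixedPointIntervalSqrt

/-!
# Reflected per-term CURVATURE CHECK for the `HomFloor` leaf replay, on the tree's fixed-point interval kernel (CERT-DESIGN-g44 §9 D1–D3)

decomp-a2c hand-2 g21 (crux `AperiodicFrustratedLawGap`, stmt-AtomisticToContinuum-27623; critic row 783 (4): kernel-evaluated shard proofs over a
reflected checker; (D1) «dyadic fixed-point ℤ intervals»).  FINDING: the (D1) kernel already exists as LITERATURE —
`Literature.Analysis.ValidatedNumerics.Numerics.FI` (scale `SC = 2^48`, outward-rounded ring operations, `divPos`, two-sided validated `FI.sqrt`,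
inclusion theorems, kernel-evaluable) — so nothing is re-implemented here.  This module is the bottom layer of the reflected `check`: for ONE lattice
term with squared-length range `[a, b] = [qlo/SC, qhi/SC]` (exact dyadics, as the box arithmetic produces them) and a candidate curvature constant
`M/SC` (the leaf record's hint), the Boolean

  `curvOK qlo qhi M`

decides the regime(s) of `[a, b]` by INTEGER comparison with the breakpoints `64/25, 9, 81/4` of `W₄₅` (a single straddle is split at the exact
breakpoint and glued; wider ranges are refused — the generator bisects), evaluates the regime's curvature expression of
`…TermCalculusSq.monotoneOn_dphi45_{bump,lj,window,far}` in `FI` arithmetic (square roots by `FI.sqrt`), and compares its upper end with `M`.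
★ `curvOK_sound : curvOK qlo qhi M = true → 0 ≤ M/SC ∧ MonotoneOn (φ′ + (M/SC)·id) (Icc (qlo/SC) (qhi/SC))` — exactly the `hM`/`hmono` inputs of
`…HomCentredForm.leaf_sound_box` for that term (`hd` is `…TermCalculus.hasDerivAt_phi45`).  Small `FI` utilities (`invPos`, `npow`, `mulRat`) are
local with their inclusion lemmas.  All definitions are computable (no `noncomputable section`); kernel smoke tests by `decide +kernel` at the end.  0 sorry; standard axioms; no instances / notation.
`--supports stmt-AtomisticToContinuum-27623`.
-/

namespace Summit.AtomisticToContinuum.Crystallization.Theorems.FrustratedLawDichotomyStrainedPatchHomTermEval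

open Set
open Literature.Analysis.ValidatedNumerics.Numerics
open Summit.AtomisticToContinuum.Crystallization.Theorems.FrustratedLawDichotomySchurCut (effPot w₄₅ ω₄)
open Summit.AtomisticToContinuum.Crystallization.Theorems.FrustratedLawDichotomyStrainedPatchHomTermCalculus
  (monotoneOn_Icc_of_pieces)
open Summit.AtomisticToContinuum.Crystallization.Theorems.FrustratedLawDichotomyStrainedPatchHomTermCalculusSq

/-! ## §1. Three small utilities on `FI` (inverse of a positive interval, natural powers, rational multiples) -/

/-- Inverse of an interval with positive lower end (total; sound under `0 < I.lo`). -/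
def invPos (I : FI) : FI := ⟨((SC : ℤ) * SC) / I.hi, cdiv ((SC : ℤ) * SC) I.lo⟩

/-- Natural power by iterated Moore multiplication. -/
def npow (I : FI) : ℕ → FI
  | 0 => FI.ofInt 1
  | n + 1 => FI.mul (npow I n) I

/-- Rational multiple `(p/q)·x` (`q > 0`): exact integer multiple, then outward division. -/
def mulRat (I : FI) (p : ℤ) (q : ℕ) : FI := FI.divNat (FI.mulInt I p) q

/-- Transport of membership along an equality of the represented reals. [folklore] -/
theorem mem_congr {x y : ℝ} {I : FI} (h : FI.mem x I) (e : x = y) : FI.mem y I := e ▸ h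

/-- Soundness of `invPos`. [folklore] -/
theorem mem_invPos {x : ℝ} {I : FI} (hx : FI.mem x I) (h : 0 < I.lo) : FI.mem x⁻¹ (invPos I) := by
  have hxpos := FI.pos_of_lo_pos hx h
  obtain ⟨h1, h2⟩ := hx
  have hS := SC_pos
  have hlo : (0:ℝ) < I.lo := by exact_mod_cast h
  have hX : 0 < x * SC := by positivity
  have hhi : (0:ℝ) < I.hi := lt_of_lt_of_le hX h2
  have hhiz : (0:ℤ) < I.hi := by exact_mod_cast hhi
  have key : x⁻¹ * SC = ((SC : ℝ) * SC) / (x * SC) := by field_simp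
  have c2 : ((((SC : ℤ) * SC : ℤ)) : ℝ) = (SC : ℝ) * SC := by push_cast; ring
  refine ⟨?_, ?_⟩
  · simp only [invPos]
    refine (fdiv_le_div hhiz).trans ?_
    rw [key, c2]
    exact div_le_div_of_nonneg_left (by positivity) hX h2
  · simp only [invPos]
    refine le_trans ?_ (div_le_cdiv h)
    rw [key, c2]
    exact div_le_div_of_nonneg_left (by positivity) hlo h1

/-- Soundness of `npow`. [folklore] -/
theorem mem_npow {x : ℝ} {I : FI} (hx : FI.mem x I) : ∀ n : ℕ, FI.mem (x ^ n) (npow I n)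
  | 0 => by
    show FI.mem (x ^ 0) (FI.ofInt 1)
    rw [pow_zero]; exact_mod_cast FI.mem_ofInt 1
  | n + 1 => by
    show FI.mem (x ^ (n + 1)) (FI.mul (npow I n) I)
    rw [pow_succ]
    exact FI.mem_mul (mem_npow hx n) hx

/-- Soundness of `mulRat`: `(p/q)·x ∈ mulRat I p q`. [folklore] -/
theorem mem_mulRat {x : ℝ} {I : FI} (hx : FI.mem x I) (p : ℤ) {q : ℕ} (hq : 0 < q) : FI.mem ((p : ℝ) / q * x) (mulRat I p q) := by
  have h := FI.mem_divNat (FI.mem_mulInt hx p) hq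
  have e : x * (p : ℝ) / q = (p : ℝ) / q * x := by ring
  rw [e] at h
  exact h

/-! ## §2. The pure-LJ piece: `2a⁻⁵ − (7/2)b⁻⁸ ≤ M/SC` -/

/-- `FI` enclosure of `2a⁻⁵ − (7/2)b⁻⁸` from `A ∋ a`, `B ∋ b`. -/
def eLJ (A B : FI) : FI := FI.sub (FI.mulInt (npow (invPos A) 5) 2) (mulRat (npow (invPos B) 8) 7 2)

/-- Inclusion for `eLJ`. [folklore] -/
theorem mem_eLJ {a b : ℝ} {A B : FI} (ha : FI.mem a A) (hb : FI.mem b B) (hA : 0 < A.lo) (hB : 0 < B.lo) :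
    FI.mem (2 * a⁻¹ ^ 5 - 7 / 2 * b⁻¹ ^ 8) (eLJ A B) := by
  have h1 := FI.mem_mulInt (mem_npow (mem_invPos ha hA) 5) 2
  have h2 := mem_mulRat (mem_npow (mem_invPos hb hB) 8) 7 (q := 2) (by norm_num)
  have h := FI.mem_sub h1 h2
  have e : a⁻¹ ^ 5 * ((2:ℤ) : ℝ) - ((7:ℤ) : ℝ) / ((2:ℕ) : ℝ) * b⁻¹ ^ 8 = 2 * a⁻¹ ^ 5 - 7 / 2 * b⁻¹ ^ 8 := by push_cast; ring
  rw [e] at h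
  exact h

/-- **LJ piece check**: positivity of the enclosures and `(eLJ A B).hi ≤ M`. -/
def ljOK (A B : FI) (M : ℤ) : Bool := decide (0 < A.lo) && decide (0 < B.lo) && decide ((eLJ A B).hi ≤ M)

/-- Soundness of the LJ piece check: `hmono` on `[a, b] ⊂ [64/25, 9]` with constant `M/SC`. [folklore] -/
theorem ljOK_sound {a b : ℝ} {A B : FI} {M : ℤ} (ha : FI.mem a A) (hb : FI.mem b B) (h64 : 64 / 25 ≤ a) (h9 : b ≤ 9)
    (h : ljOK A B M = true) :
    MonotoneOn (fun t => deriv (effPot w₄₅ ω₄ (3 / 400)) (Real.sqrt t) / (2 * Real.sqrt t) + (M : ℝ) / SC * t) (Icc a b) := by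
  simp only [ljOK, Bool.and_eq_true, decide_eq_true_eq] at h
  obtain ⟨⟨hA, hB⟩, hM⟩ := h
  have hle := FI.le_hi_div (mem_eLJ ha hb hA hB)
  have hM' : ((eLJ A B).hi : ℝ) / SC ≤ (M : ℝ) / SC := div_le_div_of_nonneg_right (by exact_mod_cast hM) SC_pos.le
  exact monotoneOn_dphi45_lj h64 h9 (hle.trans hM')

/-! ## §3. Square-root enclosures of the range endpoints -/

/-- From `a ∈ A`: `s₁ := (FI.sqrt A).lo / SC` satisfies `s₁² ≤ a` (when `0 ≤ s₁`, which the checks enforce via `0 < (FI.sqrt A).lo`). [folklore] -/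
theorem sqrtLo_sq_le {a : ℝ} {A : FI} (ha : FI.mem a A) (h0 : 0 < (FI.sqrt A).lo) : (((FI.sqrt A).lo : ℝ) / SC) ^ 2 ≤ a := by
  have hs := FI.mem_sqrt ha
  have h1 : ((FI.sqrt A).lo : ℝ) / SC ≤ Real.sqrt a := FI.lo_div_le hs
  have h0' : (0:ℝ) < ((FI.sqrt A).lo : ℝ) / SC := div_pos (by exact_mod_cast h0) SC_pos
  have hsa : 0 < Real.sqrt a := h0'.trans_le h1
  have ha0 : 0 ≤ a := le_of_lt (Real.sqrt_pos.1 hsa)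
  calc (((FI.sqrt A).lo : ℝ) / SC) ^ 2 ≤ Real.sqrt a ^ 2 := pow_le_pow_left₀ h0'.le h1 2
    _ = a := Real.sq_sqrt ha0

/-- From `b ∈ B`: `s₂ := (FI.sqrt B).hi / SC` satisfies `b ≤ s₂²` and `0 ≤ s₂` (given `0 ≤ (FI.sqrt B).hi`). [folklore] -/
theorem le_sqrtHi_sq {b : ℝ} {B : FI} (hb : FI.mem b B) (h0 : 0 ≤ (FI.sqrt B).hi) :
    b ≤ (((FI.sqrt B).hi : ℝ) / SC) ^ 2 ∧ 0 ≤ ((FI.sqrt B).hi : ℝ) / SC := by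
  have hs := FI.mem_sqrt hb
  have h1 : Real.sqrt b ≤ ((FI.sqrt B).hi : ℝ) / SC := FI.le_hi_div hs
  have h0' : (0:ℝ) ≤ ((FI.sqrt B).hi : ℝ) / SC := div_nonneg (by exact_mod_cast h0) SC_pos.le
  refine ⟨?_, h0'⟩
  rcases le_or_gt 0 b with hb0 | hb0
  · calc b = Real.sqrt b ^ 2 := (Real.sq_sqrt hb0).symm
      _ ≤ _ := pow_le_pow_left₀ (Real.sqrt_nonneg b) h1 2
  · exact hb0.le.trans (sq_nonneg _)

/-! ## §4. The window piece: `(189/2)s₁⁻¹⁶ − (143/2)s₂⁻¹⁵ + (50/3)s₁⁻¹⁴ − (11/9)s₂⁻¹³ − 54s₂⁻¹⁰ + 35s₁⁻⁹ − (20/3)s₂⁻⁸ + (10/27)s₁⁻⁷ ≤ M/SC` -/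

/-- `FI` enclosure of the window curvature expression from the scaled square-root bounds `S1 = s₁·SC`, `S2 = s₂·SC`. -/
def eWin (S1 S2 : ℤ) : FI :=
  let U := invPos (FI.ofScaled S1)
  let V := invPos (FI.ofScaled S2)
  FI.add (FI.sub (FI.add (FI.sub (FI.sub (FI.add (FI.sub (mulRat (npow U 16) 189 2) (mulRat (npow V 15) 143 2))
    (mulRat (npow U 14) 50 3)) (mulRat (npow V 13) 11 9)) (FI.mulInt (npow V 10) 54)) (FI.mulInt (npow U 9) 35))
    (mulRat (npow V 8) 20 3)) (mulRat (npow U 7) 10 27)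

/-- Inclusion for `eWin`. [folklore] -/
theorem mem_eWin {S1 S2 : ℤ} (h1 : 0 < S1) (h2 : 0 < S2) :
    FI.mem (189 / 2 * ((S1 : ℝ) / SC)⁻¹ ^ 16 - 143 / 2 * ((S2 : ℝ) / SC)⁻¹ ^ 15 + 50 / 3 * ((S1 : ℝ) / SC)⁻¹ ^ 14 -
      11 / 9 * ((S2 : ℝ) / SC)⁻¹ ^ 13 - 54 * ((S2 : ℝ) / SC)⁻¹ ^ 10 + 35 * ((S1 : ℝ) / SC)⁻¹ ^ 9 - 20 / 3 * ((S2 : ℝ) / SC)⁻¹ ^ 8 +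
      10 / 27 * ((S1 : ℝ) / SC)⁻¹ ^ 7) (eWin S1 S2) := by
  have hU := mem_invPos (FI.mem_ofScaled S1) (by exact h1)
  have hV := mem_invPos (FI.mem_ofScaled S2) (by exact h2)
  have t16 := mem_mulRat (mem_npow hU 16) 189 (q := 2) (by norm_num)
  have t15 := mem_mulRat (mem_npow hV 15) 143 (q := 2) (by norm_num)
  have t14 := mem_mulRat (mem_npow hU 14) 50 (q := 3) (by norm_num)
  have t13 := mem_mulRat (mem_npow hV 13) 11 (q := 9) (by norm_num)
  have t10 := FI.mem_mulInt (mem_npow hV 10) 54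
  have t9 := FI.mem_mulInt (mem_npow hU 9) 35
  have t8 := mem_mulRat (mem_npow hV 8) 20 (q := 3) (by norm_num)
  have t7 := mem_mulRat (mem_npow hU 7) 10 (q := 27) (by norm_num)
  have h := FI.mem_add (FI.mem_sub (FI.mem_add (FI.mem_sub (FI.mem_sub (FI.mem_add (FI.mem_sub t16 t15) t14) t13) t10) t9) t8) t7
  exact mem_congr h (by push_cast; ring)

/-- **Window piece check**. -/
def winOK (A B : FI) (M : ℤ) : Bool :=
  decide (0 < (FI.sqrt A).lo) && decide (0 < (FI.sqrt B).hi) && decide ((eWin (FI.sqrt A).lo (FI.sqrt B).hi).hi ≤ M)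

/-- Soundness of the window piece check: `hmono` on `[a, b] ⊂ [9, 81/4]` with constant `M/SC`. [folklore] -/
theorem winOK_sound {a b : ℝ} {A B : FI} {M : ℤ} (ha : FI.mem a A) (hb : FI.mem b B) (h9 : 9 ≤ a) (h81 : b ≤ 81 / 4)
    (h : winOK A B M = true) :
    MonotoneOn (fun t => deriv (effPot w₄₅ ω₄ (3 / 400)) (Real.sqrt t) / (2 * Real.sqrt t) + (M : ℝ) / SC * t) (Icc a b) := by
  simp only [winOK, Bool.and_eq_true, decide_eq_true_eq] at h
  obtain ⟨⟨hS1, hS2⟩, hM⟩ := h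
  have hs1 : (0:ℝ) < ((FI.sqrt A).lo : ℝ) / SC := div_pos (by exact_mod_cast hS1) SC_pos
  have h1 := sqrtLo_sq_le ha hS1
  obtain ⟨h2, hs2⟩ := le_sqrtHi_sq hb hS2.le
  have hle := FI.le_hi_div (mem_eWin hS1 hS2)
  have hM' : ((eWin (FI.sqrt A).lo (FI.sqrt B).hi).hi : ℝ) / SC ≤ (M : ℝ) / SC :=
    div_le_div_of_nonneg_right (by exact_mod_cast hM) SC_pos.le
  exact monotoneOn_dphi45_window h9 h81 hs1 h1 h2 hs2 (hle.trans hM')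

/-! ## §5. The bump piece: `2a⁻⁵ − (7/2)b⁻⁸ + (75/8192)(33/2 − (1155/64)x₁ + (1155/256)x₂³ − (693/1024)x₁⁵ + (165/4096)x₂⁷) ≤ M/SC`, `xᵢ = 5sᵢ/4` -/

/-- `FI` enclosure of the bump curvature expression from `A ∋ a`, `B ∋ b` and the scaled square-root bounds `S1`, `S2`. -/
def eBump (A B : FI) (S1 S2 : ℤ) : FI :=
  let X1 := mulRat (FI.ofScaled S1) 5 4
  let X2 := mulRat (FI.ofScaled S2) 5 4
  FI.add (eLJ A B) (mulRat (FI.add (FI.sub (FI.add (FI.sub (FI.ofFrac 33 2) (mulRat X1 1155 64)) (mulRat (npow X2 3) 1155 256))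
    (mulRat (npow X1 5) 693 1024)) (mulRat (npow X2 7) 165 4096)) 75 8192)

/-- Inclusion for `eBump`. [folklore] -/
theorem mem_eBump {a b : ℝ} {A B : FI} {S1 S2 : ℤ} (ha : FI.mem a A) (hb : FI.mem b B) (hA : 0 < A.lo) (hB : 0 < B.lo) :
    FI.mem (2 * a⁻¹ ^ 5 - 7 / 2 * b⁻¹ ^ 8 + 75 / 8192 * (33 / 2 - 1155 / 64 * (5 * ((S1 : ℝ) / SC) / 4) +
      1155 / 256 * (5 * ((S2 : ℝ) / SC) / 4) ^ 3 - 693 / 1024 * (5 * ((S1 : ℝ) / SC) / 4) ^ 5 + 165 / 4096 * (5 * ((S2 : ℝ) / SC) / 4) ^ 7))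
      (eBump A B S1 S2) := by
  have hX1 := mem_mulRat (FI.mem_ofScaled S1) 5 (q := 4) (by norm_num)
  have hX2 := mem_mulRat (FI.mem_ofScaled S2) 5 (q := 4) (by norm_num)
  have c0 := FI.mem_ofFrac 33 (q := 2) (by norm_num)
  have u1 := mem_mulRat hX1 1155 (q := 64) (by norm_num)
  have u3 := mem_mulRat (mem_npow hX2 3) 1155 (q := 256) (by norm_num)
  have u5 := mem_mulRat (mem_npow hX1 5) 693 (q := 1024) (by norm_num)
  have u7 := mem_mulRat (mem_npow hX2 7) 165 (q := 4096) (by norm_num)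
  have hT := mem_mulRat (FI.mem_add (FI.mem_sub (FI.mem_add (FI.mem_sub c0 u1) u3) u5) u7) 75 (q := 8192) (by norm_num)
  have h := FI.mem_add (mem_eLJ ha hb hA hB) hT
  exact mem_congr h (by push_cast; ring)

/-- **Bump piece check**. -/
def bumpOK (A B : FI) (M : ℤ) : Bool :=
  decide (0 < A.lo) && decide (0 < B.lo) && decide (0 < (FI.sqrt A).lo) && decide (0 ≤ (FI.sqrt B).hi) &&
    decide ((eBump A B (FI.sqrt A).lo (FI.sqrt B).hi).hi ≤ M)

/-- Soundness of the bump piece check: `hmono` on `[a, b]` with `b ≤ 64/25`, constant `M/SC`. [folklore] -/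
theorem bumpOK_sound {a b : ℝ} {A B : FI} {M : ℤ} (ha : FI.mem a A) (hb : FI.mem b B) (h64 : b ≤ 64 / 25) (h : bumpOK A B M = true) :
    MonotoneOn (fun t => deriv (effPot w₄₅ ω₄ (3 / 400)) (Real.sqrt t) / (2 * Real.sqrt t) + (M : ℝ) / SC * t) (Icc a b) := by
  simp only [bumpOK, Bool.and_eq_true, decide_eq_true_eq] at h
  obtain ⟨⟨⟨⟨hA, hB⟩, hS1⟩, hS2⟩, hM⟩ := h
  have hs1 : (0:ℝ) < ((FI.sqrt A).lo : ℝ) / SC := div_pos (by exact_mod_cast hS1) SC_pos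
  have h1 := sqrtLo_sq_le ha hS1
  obtain ⟨h2, hs2⟩ := le_sqrtHi_sq hb hS2
  have hle := FI.le_hi_div (mem_eBump (S1 := (FI.sqrt A).lo) (S2 := (FI.sqrt B).hi) ha hb hA hB)
  have hM' : ((eBump A B (FI.sqrt A).lo (FI.sqrt B).hi).hi : ℝ) / SC ≤ (M : ℝ) / SC :=
    div_le_div_of_nonneg_right (by exact_mod_cast hM) SC_pos.le
  exact monotoneOn_dphi45_bump h64 hs1 h1 h2 hs2 (hle.trans hM')

/-! ## §6. The term-level check: regime detection by integer comparison, one straddle allowed, glue -/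

/-- Reading an integer comparison `n·q ≤ m·SC` as `q/SC ≤ m/n`. [folklore] -/
theorem div_SC_le_of {q m : ℤ} {n : ℕ} (hn : 0 < n) (h : (n : ℤ) * q ≤ m * SC) : (q : ℝ) / SC ≤ (m : ℝ) / n := by
  have hn' : (0:ℝ) < n := by exact_mod_cast hn
  rw [div_le_div_iff₀ SC_pos hn']
  have : ((n : ℤ) : ℝ) * q ≤ m * SC := by exact_mod_cast h
  push_cast at this; linarith

/-- Reading an integer comparison `m·SC ≤ n·q` as `m/n ≤ q/SC`. [folklore] -/
theorem le_div_SC_of {q m : ℤ} {n : ℕ} (hn : 0 < n) (h : m * (SC : ℤ) ≤ (n : ℤ) * q) : (m : ℝ) / n ≤ (q : ℝ) / SC := by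
  have hn' : (0:ℝ) < n := by exact_mod_cast hn
  rw [div_le_div_iff₀ hn' SC_pos]
  have : (m : ℝ) * SC ≤ ((n : ℤ) : ℝ) * q := by exact_mod_cast h
  push_cast at this; linarith

/-- ★ **THE TERM CURVATURE CHECK** for a term with squared-length range `[qlo/SC, qhi/SC]` and candidate constant `M/SC`:
`M ≥ 0`, `qlo > 0`, `qlo ≤ qhi`, then by integer comparison with `64/25, 9, 81/4`: a single-regime range is checked by that regime's piece check;
a range straddling ONE breakpoint is split there (pieces checked with the exact breakpoint as an `FI.ofFrac` endpoint); anything wider is refused. -/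
def curvOK (qlo qhi M : ℤ) : Bool :=
  let A := FI.ofScaled qlo
  let B := FI.ofScaled qhi
  decide (0 ≤ M) && decide (0 < qlo) && decide (qlo ≤ qhi) &&
    (if 25 * qhi ≤ 64 * (SC : ℤ) then bumpOK A B M
    else if 64 * (SC : ℤ) ≤ 25 * qlo then
      (if qhi ≤ 9 * (SC : ℤ) then ljOK A B M
      else if 9 * (SC : ℤ) ≤ qlo then
        (if 4 * qhi ≤ 81 * (SC : ℤ) then winOK A B M
        else if 81 * (SC : ℤ) ≤ 4 * qlo then true
        else winOK A (FI.ofFrac 81 4) M)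
      else decide (4 * qhi ≤ 81 * (SC : ℤ)) && ljOK A (FI.ofInt 9) M && winOK (FI.ofInt 9) B M)
    else decide (qhi ≤ 9 * (SC : ℤ)) && bumpOK A (FI.ofFrac 64 25) M && ljOK (FI.ofFrac 64 25) B M)

/-- ★★ **SOUNDNESS OF THE TERM CURVATURE CHECK**: `curvOK qlo qhi M = true` delivers the `hM`/`hmono` inputs of `…HomCentredForm.leaf_sound_box` for a term
with squared-length range `[qlo/SC, qhi/SC]`: `0 ≤ M/SC` and `φ′ + (M/SC)·id` monotone there. [folklore] -/
theorem curvOK_sound {qlo qhi M : ℤ} (h : curvOK qlo qhi M = true) :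
    0 ≤ (M : ℝ) / SC ∧
      MonotoneOn (fun t => deriv (effPot w₄₅ ω₄ (3 / 400)) (Real.sqrt t) / (2 * Real.sqrt t) + (M : ℝ) / SC * t)
        (Icc ((qlo : ℝ) / SC) ((qhi : ℝ) / SC)) := by
  have ha := FI.mem_ofScaled qlo
  have hb := FI.mem_ofScaled qhi
  have hk1 : FI.mem ((64 : ℝ) / 25) (FI.ofFrac 64 25) := mem_congr (FI.mem_ofFrac 64 (q := 25) (by norm_num)) (by norm_num)
  have hk2 : FI.mem (9 : ℝ) (FI.ofInt 9) := mem_congr (FI.mem_ofInt 9) (by norm_num)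
  have hk3 : FI.mem ((81 : ℝ) / 4) (FI.ofFrac 81 4) := mem_congr (FI.mem_ofFrac 81 (q := 4) (by norm_num)) (by norm_num)
  unfold curvOK at h
  simp only [Bool.and_eq_true, decide_eq_true_eq] at h
  obtain ⟨⟨⟨hM0, hq0⟩, hqq⟩, h⟩ := h
  refine ⟨div_nonneg (by exact_mod_cast hM0) SC_pos.le, ?_⟩
  have hab : (qlo : ℝ) / SC ≤ (qhi : ℝ) / SC := div_le_div_of_nonneg_right (by exact_mod_cast hqq) SC_pos.le
  split_ifs at h with c1 c2 c3 c4 c5 c6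
  · -- b ≤ 64/25: bump
    exact bumpOK_sound ha hb (div_SC_le_of (by norm_num) (by simpa using c1)) h
  · -- 64/25 ≤ a, b ≤ 9: LJ
    exact ljOK_sound ha hb (le_div_SC_of (by norm_num) (by simpa using c2)) (div_SC_le_of (n := 1) (by norm_num) (by simpa using c3) |>.trans
      (by norm_num)) h
  · -- 9 ≤ a, b ≤ 81/4: window
    exact winOK_sound ha hb ((show (9:ℝ) = (9:ℤ)/(1:ℕ) by norm_num) ▸ le_div_SC_of (by norm_num) (by simpa using c4))
      (div_SC_le_of (by norm_num) (by simpa using c5)) h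
  · -- 81/4 ≤ a: far
    exact monotoneOn_dphi45_far (le_div_SC_of (by norm_num) (by simpa using c6)) (div_nonneg (by exact_mod_cast hM0) SC_pos.le)
  · -- straddle 81/4: window on [a, 81/4], far on [81/4, b]
    have ha9 : (9 : ℝ) ≤ (qlo : ℝ) / SC := (show (9:ℝ) = (9:ℤ)/(1:ℕ) by norm_num) ▸ le_div_SC_of (by norm_num) (by simpa using c4)
    have hlt1 : (qlo : ℝ) / SC ≤ 81 / 4 := by
      have : ¬ (81 * (SC : ℤ) ≤ 4 * qlo) := c6
      have h' : 4 * qlo ≤ 81 * (SC : ℤ) := by linarith [not_le.1 this]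
      exact div_SC_le_of (by norm_num) (by simpa using h')
    have hgt1 : (81 : ℝ) / 4 ≤ (qhi : ℝ) / SC := by
      have : ¬ (4 * qhi ≤ 81 * (SC : ℤ)) := c5
      have h' : 81 * (SC : ℤ) ≤ 4 * qhi := by linarith [not_le.1 this]
      exact le_div_SC_of (by norm_num) (by simpa using h')
    exact monotoneOn_Icc_of_pieces hlt1 hgt1 (winOK_sound ha hk3 ha9 le_rfl h)
      (monotoneOn_dphi45_far le_rfl (div_nonneg (by exact_mod_cast hM0) SC_pos.le))
  · -- straddle 9: LJ on [a, 9], window on [9, b]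
    simp only [Bool.and_eq_true, decide_eq_true_eq] at h
    obtain ⟨⟨c7, hL⟩, hW⟩ := h
    have ha64 : (64 : ℝ) / 25 ≤ (qlo : ℝ) / SC := le_div_SC_of (by norm_num) (by simpa using c2)
    have hlt : (qlo : ℝ) / SC ≤ 9 := by
      have : ¬ (9 * (SC : ℤ) ≤ qlo) := c4
      have h' : (1:ℕ) * qlo ≤ 9 * (SC : ℤ) := by push_cast; linarith [not_le.1 this]
      exact (div_SC_le_of (by norm_num) h').trans (by norm_num)
    have hgt : (9 : ℝ) ≤ (qhi : ℝ) / SC := by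
      have : ¬ (qhi ≤ 9 * (SC : ℤ)) := c3
      have h' : 9 * (SC : ℤ) ≤ (1:ℕ) * qhi := by push_cast; linarith [not_le.1 this]
      exact le_trans (by norm_num) (le_div_SC_of (by norm_num) h')
    have hb81 : (qhi : ℝ) / SC ≤ 81 / 4 := div_SC_le_of (by norm_num) (by simpa using c7)
    exact monotoneOn_Icc_of_pieces hlt hgt (ljOK_sound ha hk2 ha64 le_rfl hL) (winOK_sound hk2 hb le_rfl hb81 hW)
  · -- straddle 64/25: bump on [a, 64/25], LJ on [64/25, b]
    simp only [Bool.and_eq_true, decide_eq_true_eq] at h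
    obtain ⟨⟨c7, hBu⟩, hL⟩ := h
    have hlt : (qlo : ℝ) / SC ≤ 64 / 25 := by
      have : ¬ (64 * (SC : ℤ) ≤ 25 * qlo) := c2
      have h' : 25 * qlo ≤ 64 * (SC : ℤ) := by linarith [not_le.1 this]
      exact div_SC_le_of (by norm_num) (by simpa using h')
    have hgt : (64 : ℝ) / 25 ≤ (qhi : ℝ) / SC := by
      have : ¬ (25 * qhi ≤ 64 * (SC : ℤ)) := c1
      have h' : 64 * (SC : ℤ) ≤ 25 * qhi := by linarith [not_le.1 this]
      exact le_div_SC_of (by norm_num) (by simpa using h')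
    have hb9 : (qhi : ℝ) / SC ≤ 9 := by
      have h' : (1:ℕ) * qhi ≤ 9 * (SC : ℤ) := by push_cast; linarith
      exact (div_SC_le_of (by norm_num) h').trans (by norm_num)
    exact monotoneOn_Icc_of_pieces hlt hgt (bumpOK_sound ha hk1 le_rfl hBu) (ljOK_sound hk1 hb le_rfl hb9 hL)

/-! ## §7. Kernel smoke test -/

/-- A pure-LJ term of a real leaf: `q ∈ [3.0, 3.01]` (scaled), candidate `M/SC ≈ 8.3·10⁻³ ≥ 2·3⁻⁵ − (7/2)·3.01⁻⁸`: accepted by kernel evaluation. -/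
example : curvOK (3 * (SC : ℤ)) (3 * (SC : ℤ) + (SC : ℤ) / 100) (SC / 120) = true := by decide +kernel

/-- A window term `q ∈ [12, 12.05]` (square roots by the validated Newton `FI.sqrt`, sixteen-fold Moore powers) — kernel-evaluated. -/
example : curvOK (12 * (SC : ℤ)) (12 * (SC : ℤ) + (SC : ℤ) / 20) (SC / 100) = true := by decide +kernel

/-- A first-shell bump term `q ∈ [0.9, 0.905]` (the steep LJ core: `M = 0` already suffices there since `φ″ > 0`). -/
example : curvOK (9 * (SC : ℤ) / 10) (905 * (SC : ℤ) / 1000) 0 = true := by decide +kernel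

/-- A range straddling the cutoff onset `q = 9` (`[8.99, 9.01]`): split at `9`, both pieces checked, glued. -/
example : curvOK (899 * (SC : ℤ) / 100) (901 * (SC : ℤ) / 100) (SC / 100) = true := by decide +kernel

/-- … and an insufficient constant is rejected (`q ∈ [0.9, 0.905]` needs `M/SC ≥ 2·0.9⁻⁵ − 3.5·0.905⁻⁸ − 0.011 ≈ −4.4`, so `M = −5·SC` fails on `0 ≤ M`). -/
example : curvOK (9 * (SC : ℤ) / 10) (905 * (SC : ℤ) / 1000) (-5 * (SC : ℤ)) = false := by decide +kernel

end Summit.AtomisticToContinuum.Crystallization.Theorems.FrustratedLawDichotomyStrainedPatchHomTermEval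

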